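import Literature.AlgebraicGeometry.Resolution.NormalizationInExtension
import Literature.AlgebraicGeometry.Resolution.Temkin2008LocalizationProofs

/-!
# Sketch — stub-ideation k=2 (FAMILY 2, RESHAPE) for `stub_picoverDegP` of crux `Picover` (stmt-0554)

Typed helper-lemma statements for `STUB-IDEAS-stub_picoverDegP-2.md`. Sorries only; this file is a
type-check of the STATEMENTS, not a proof attempt.
-/

noncomputable section

open CategoryTheory AlgebraicGeometry TopologicalSpace IsLocalRing
open Literature.AlgebraicGeometry.Resolution

namespace Summit.ResolutionOfSingularities.ResolutionOfSingularities.Cruxes.Picover.StubIdeas2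

universe u

/-! ## Plan A — strengthen to Temkin's blow-up form, localise, induct on `dim` -/

/-- **A1 (S).** Per-scheme localisation of desingularization: the in-tree proof
`temkin2008_prop234_of_comp` / `Temkin2008_prop234_holds` applies its local hypothesis only to the
given `X`; copy it with `hloc` restricted to `X`. -/
theorem admitsDesingularization_of_localBlowups {B X : Scheme.{u}} [IsNoetherian B]
    (hB : Scheme.IsQuasiExcellent B) (f₀ : X ⟶ B) [IsIntegral X] [LocallyOfFiniteType f₀]
    [QuasiCompact f₀]
    (hloc : ∀ (x : X) (S' : Scheme.{u}) (g : S' ⟶ Spec (X.presheaf.stalk x))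
      (I : (Spec (X.presheaf.stalk x)).IdealSheafData), IsBlowup g I →
      (∀ s : S', s ∉ Scheme.regularLocus S' → g s = closedPoint (X.presheaf.stalk x)) →
      Scheme.AdmitsDesingularization S') :
    Scheme.AdmitsDesingularization X := by
  sorry

/-- **A4 (M).** Partial run of the same Noetherian induction: if the local hypothesis holds at every
NON-CLOSED point, `X` is desingularised by a `Sing`-supported blow-up off the fibres of finitely
many closed points (run the induction while the bad closed set `C` has a non-closed point; a
closed set of closed points in a Noetherian space is finite). -/
theorem exists_isBlowup_regular_off_finite {B X : Scheme.{u}} [IsNoetherian B]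
    (hB : Scheme.IsQuasiExcellent B) (f₀ : X ⟶ B) [IsIntegral X] [LocallyOfFiniteType f₀]
    [QuasiCompact f₀]
    (hloc : ∀ (x : X), ¬ IsClosed ({x} : Set X) → ∀ (S' : Scheme.{u})
      (g : S' ⟶ Spec (X.presheaf.stalk x)) (I : (Spec (X.presheaf.stalk x)).IdealSheafData),
      IsBlowup g I →
      (∀ s : S', s ∉ Scheme.regularLocus S' → g s = closedPoint (X.presheaf.stalk x)) →
      Scheme.AdmitsDesingularization S') :
    ∃ (X' : Scheme.{u}) (f : X' ⟶ X) (J : X.IdealSheafData) (F : Set X), IsBlowup f J ∧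
      (J.support : Set X) ⊆ (Scheme.regularLocus X)ᶜ ∧ F.Finite ∧
      (∀ x ∈ F, IsClosed ({x} : Set X)) ∧ ∀ x' : X', f x' ∉ F → x' ∈ Scheme.regularLocus X' := by
  sorry

/-- **R_A(p,d) — the research residual of Plan A, typed.** PUNCTUAL DESINGULARIZATION of local
height-one covers = Temkin's condition (iii) for the class: for every field `k` of char `p`, every
regular local `R` essentially of finite type over `k` with `dim R ≤ d`, every purely inseparable
`L ⊇ K = Frac R` of degree `p`, every blow-up `S'` of the local scheme `Spec (IC_L R)` whose
singular points lie over the closed point of `Spec R` admits a desingularization. -/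
def PunctualDesing (p d : ℕ) : Prop :=
  ∀ (k R K L : Type) [Field k] [CharP k p] [CommRing R] [IsRegularLocalRing R] [Algebra k R]
    [Algebra.EssFiniteType k R] [Field K] [Algebra R K] [IsFractionRing R K] [Field L]
    [Algebra K L] [Algebra R L] [IsScalarTower R K L] [IsPurelyInseparable K L],
    Module.finrank K L = p → ringKrullDim R ≤ d →
    ∀ (S' : Scheme.{0}) (g : S' ⟶ Spec (.of (integralClosure R L)))
      (I : (Spec (.of (integralClosure R L))).IdealSheafData), IsBlowup g I →
      (∀ s : S', s ∉ Scheme.regularLocus S' →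
        (g ≫ Spec.map (CommRingCat.ofHom (algebraMap R (integralClosure R L)))) s =
          closedPoint R) →
      Scheme.AdmitsDesingularization S'

/-- **A2 (M).** The stalk of `W^L` at the (unique) point over `w` is the integral closure of
`𝒪_{W,w}` in `L` (normalisation commutes with localisation; `normalizationInι` is a homeomorphism). -/
theorem nonempty_stalk_normalizationIn_iso (W : Scheme.{0}) [IsIntegral W] (L : Type) [Field L]
    [Algebra W.functionField L] [Algebra.IsAlgebraic W.functionField L]
    (x : normalizationIn W L) :
    letI w : W := normalizationInι W L x
    letI : Algebra (W.presheaf.stalk w) L :=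
      ((algebraMap W.functionField L).comp (algebraMap (W.presheaf.stalk w) W.functionField)).toAlgebra
    Nonempty ((normalizationIn W L).presheaf.stalk x ≅
      CommRingCat.of (integralClosure (W.presheaf.stalk w) L)) := by
  sorry

/-- **A3 (M, assembly of Plan A).** `stub_picoverDegP` from punctual desingularization in every
dimension: `𝒪_{X,x} ≅ IC_L(𝒪_{W,w})` (A2), `𝒪_{W,w}` regular local essentially of finite type over
`k` (so R_A supplies Temkin's local hypothesis at EVERY point, closed or not), A1 over the base
`Spec k` (quasi-excellent: `isQuasiExcellentRing_of_field`), and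
`Scheme.AdmitsDesingularization.hasResolution`. -/
theorem stub_picoverDegP_of_punctualDesing (p : ℕ) (hp : p.Prime)
    (h : ∀ d : ℕ, PunctualDesing p d) :
    ∀ (k : Type) [Field k] [CharP k p] (W : Scheme.{0}) [IsIntegral W] (f : W ⟶ Spec (.of k))
      (L : Type) [Field L] [Algebra W.functionField L], IsSeparated f → LocallyOfFiniteType f →
      QuasiCompact f → Scheme.IsRegular W → IsPurelyInseparable W.functionField L →
      Module.finrank W.functionField L = p → Scheme.HasResolution (normalizationIn W L) := by
  sorry

/-! ## Plan B — dualise: bottom-regular degree-`p` cover ↦ top-regular rank-one quotients -/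

/-- **B1 (S, F-finite case — trivial: `R' := R` via Frobenius).** A REGULAR finite height-one hull
containing `f^{1/p}` exists whenever Frobenius is finite on `R`. -/
theorem exists_regular_heightOne_hull_of_frobenius_finite (p : ℕ) [Fact p.Prime] (R : Type)
    [CommRing R] [IsRegularLocalRing R] [CharP R p] (hF : (frobenius R p).Finite) (f : R) :
    ∃ (R' : Type) (_ : CommRing R') (_ : IsRegularLocalRing R') (_ : Algebra R R'),
      Module.Finite R R' ∧ Function.Injective (algebraMap R R') ∧
      (∀ r' : R', ∃ r : R, algebraMap R R' r = r' ^ p) ∧ ∃ t : R', t ^ p = algebraMap R R' f := by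
  sorry

/-- **B1-gen (M, conjectural for `[k : k^p] = ∞`).** Same conclusion for every regular local ring
essentially of finite type over ANY field of char `p` (iterate the landed
`isRegularLocalRing_adjoinRoot_of_transversal` / `…_of_wound` over a regular system of parameters
and finitely many units with `p`-independent residues; the content is that finitely many suffice
to make `f` a `p`-th power). -/
theorem exists_regular_heightOne_hull (p : ℕ) [Fact p.Prime] (k R : Type) [Field k] [CharP k p]
    [CommRing R] [IsRegularLocalRing R] [Algebra k R] [Algebra.EssFiniteType k R] (f : R) :
    ∃ (R' : Type) (_ : CommRing R') (_ : IsRegularLocalRing R') (_ : Algebra R R'),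
      Module.Finite R R' ∧ Function.Injective (algebraMap R R') ∧
      (∀ r' : R', ∃ r : R, algebraMap R R' r = r' ^ p) ∧ ∃ t : R', t ^ p = algebraMap R R' f := by
  sorry

/-- **B3 (M).** MULTIPLICATIVE ⟹ LINEARISABLE: a derivation with `D^p = D` (a `μ_p`-action =
`ℤ/p`-grading `R = ⊕ ker (D − a)`, Lagrange interpolation over `𝔽_p ⊆ R`) preserving `𝔪` admits a
regular system of parameters of `D`-eigenvectors; the ring of constants is then formally the toric
ring `κ⟦x⟧^{μ_p}` (Rudakov–Shafarevich; Posva arXiv:2311.16694 Prop. 11–12). -/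
theorem exists_eigen_regularParameters {R : Type} [CommRing R] [IsRegularLocalRing R] (p : ℕ)
    [Fact p.Prime] [CharP R p] (D : Derivation ℤ R R) (hD : ∀ r, (⇑D)^[p] r = D r)
    (hm : ∀ r ∈ maximalIdeal R, D r ∈ maximalIdeal R) :
    ∃ (n : ℕ) (s : Fin n → R) (a : Fin n → ℕ), Ideal.span (Set.range s) = maximalIdeal R ∧
      (n : WithBot ℕ∞) = ringKrullDim R ∧ ∀ i, D (s i) = (a i : R) * s i := by
  sorry

end Summit.ResolutionOfSingularities.ResolutionOfSingularities.Cruxes.Picover.StubIdeas2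

end
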